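import Mathlib.Analysis.InnerProductSpace.Basic
import Summits.NavierStokesRegularity.NavierStokesRegularity.Theorems.CertifiedBlowupConditions

/-!
# NavierStokesRegularity — route `CertifiedBlowup`: junk-frame audit of `BlowupProfileConditions`

Junk-model audit (refuter) for `stmt-NavierStokesRegularity-0269` / `-0270` (informal: "`∀ d,
BlowupProfileConditions d → X5a`", "`∃ d, BlowupProfileConditions d`"). The definition that landed
(`Conditions.lean`) is `BlowupProfileConditions (d) (F : StabilityFrame d) : Prop` with the analytic
frame `F` an explicit parameter. This file shows that the frame parameter excludes nothing: for
EVERY datum `d` whose scalar constants pass the (decidable) scalar tests — `0 ≤ ε`, all `cⱼ ≥ 0`,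
closure at some `E*`, admissible exponents — the one-dimensional junk frame `X = ℝ`,
`reconstruct ≡ 0`, `residual = 0`, `linForm v = −κ v²`, `nonlinForms ≡ 0` satisfies the full
package (i)–(iv). Consequences for typing:

* `∃ d F, BlowupProfileConditions d F` (0270 with `∃ F`) is provable outright
  (`exists_blowupProfileConditions_junk`, with a well-formed datum), hence carries no analytic
  content;
* `∀ d F, BlowupProfileConditions d F → X5a` (0269 with `∀ F`) is equivalent to `X5a` itself.

Honest typing of 0269/0270 therefore needs the canonical frame `nsFrame d` (rescaled axisymmetric
Navier–Stokes operator on the reconstruction of `d`), as the module docstring of `Conditions.lean`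
already says; this file is the executable form of that remark.
-/

noncomputable section

namespace Literature.NS


/-- **The frame parameter excludes nothing.** If the scalar constants of `d` pass the scalar
tests (`0 ≤ ε`, every `cⱼ ≥ 0`, closure at some threshold, admissible exponents) then some frame —
the one-dimensional junk frame `X = ℝ`, `reconstruct ≡ 0`, `residual = 0`, `linForm v = −κ ‖v‖²`,
`nonlinForms ≡ 0` — satisfies the whole package `BlowupProfileConditions d F`. Junk-model audit for
stmt-NavierStokesRegularity-0269/0270. [folklore] -/
theorem exists_frame_blowupProfileConditions (d : BlowupProfileData)
    (hε : 0 ≤ d.residualBound) (hc : ∀ c ∈ d.nonlinearConsts, (0 : ℚ) ≤ c)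
    (hclos : ∃ Estar : ℝ, d.ClosureAt Estar) (hexp : d.ExponentsAdmissible) :
    ∃ F : StabilityFrame d, BlowupProfileConditions d F := by
  refine ⟨{ X := ℝ, reconstruct := fun _ => 0, residual := 0,
            linForm := fun v => -(d.coercivity : ℝ) * ‖v‖ ^ 2,
            nonlinForms := d.nonlinearConsts.map fun _ => fun _ => 0 }, ?_, fun v _ => le_rfl, ?_, hclos, hexp⟩
  · show ‖(0 : ℝ)‖ ≤ (d.residualBound : ℝ)
    simpa using (show (0 : ℝ) ≤ d.residualBound by exact_mod_cast hε)
  · show List.Forall₂ _ (d.nonlinearConsts.map fun _ => fun (_ : ℝ) => (0 : ℝ)) d.nonlinearConsts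
    have key : ∀ cs : List ℚ, (∀ c ∈ cs, (0 : ℚ) ≤ c) →
        List.Forall₂ (fun (N : ℝ → ℝ) (c : ℚ) => ∀ v : ℝ, |N v| ≤ (c : ℝ) * ‖v‖ ^ 3)
          (cs.map fun _ => fun (_ : ℝ) => (0 : ℝ)) cs := by
      intro cs hcs
      induction cs with
      | nil => exact List.Forall₂.nil
      | cons c cs ih =>
        refine List.Forall₂.cons ?_ (ih fun c' hc' => hcs c' (List.mem_cons_of_mem _ hc'))
        intro v
        have : (0 : ℝ) ≤ c := by exact_mod_cast hcs c List.mem_cons_self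
        simpa using mul_nonneg this (by positivity : (0 : ℝ) ≤ ‖v‖ ^ 3)
    exact key _ hc

/-- **Junk inhabitant of the certified-blow-up package.** There is a well-formed datum (shape
`1 × 1 × 1`, `(c_l, c_ω) = (1/2, −1)` = exact Navier–Stokes self-similar scaling, `ε = 1/1000`,
`κ = 1/10`, `c = [1, 1]`, domain `10 × 10`, unstable rank `1`; NOT a certified profile) with
admissible exponents and a frame satisfying `BlowupProfileConditions`, so
`∃ d F, BlowupProfileConditions d F` has no analytic content. [folklore] -/
theorem exists_blowupProfileConditions_junk :
    ∃ d : BlowupProfileData, d.IsWellFormed ∧ 0 < d.unstableRank ∧ 0 < d.numCoeffs ∧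
      d.closureDiscriminant ∧ d.ExponentsAdmissible ∧
      ∃ F : StabilityFrame d, BlowupProfileConditions d F := by
  let d : BlowupProfileData :=
    { symmetry := .axisymSwirlOdd, cl := 1 / 2, cw := -1, numComponents := 1, degR := 1, degZ := 1,
      coeff := fun _ _ _ => 1, domainRadius := 10, domainHeight := 10, unstableRank := 1,
      unstableBasis := fun _ _ _ _ => 1, residualBound := 1 / 1000, coercivity := 1 / 10,
      nonlinearConsts := [1, 1] }
  have hdisc : d.closureDiscriminant := by
    norm_num [BlowupProfileData.closureDiscriminant, BlowupProfileData.nonlinConst, d]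
  have hexp : d.ExponentsAdmissible := by norm_num [BlowupProfileData.ExponentsAdmissible, d]
  exact ⟨d, by norm_num [BlowupProfileData.IsWellFormed, d], Nat.one_pos,
    by norm_num [BlowupProfileData.numCoeffs, d], hdisc, hexp,
    exists_frame_blowupProfileConditions d (by norm_num [d]) (by simp [d])
      (BlowupProfileData.exists_closureAt d hdisc) hexp⟩

/-- Corollary: quantifying the frame universally makes the package hypothesis disposable —
for any proposition `P`, `(∀ d F, BlowupProfileConditions d F → P) ↔ P`; in particular
"`∀ d F, BlowupProfileConditions d F → X5a`" is just `X5a`. [folklore] -/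
theorem forall_blowupProfileConditions_iff (P : Prop) :
    (∀ (d : BlowupProfileData) (F : StabilityFrame d), BlowupProfileConditions d F → P) ↔ P := by
  refine ⟨fun h => ?_, fun hP _ _ _ => hP⟩
  obtain ⟨d, -, -, -, -, -, F, hF⟩ := exists_blowupProfileConditions_junk
  exact h d F hF

/-- **Exact content of the frame-quantified package** (sharpens
`exists_frame_blowupProfileConditions`: an `iff`, and no sign condition on the `cⱼ`): quantifying
over the frame makes `BlowupProfileConditions` equivalent to three scalar rational conditions on the
datum — `0 ≤ ε`, closure at some `E*`, admissible exponents. The witness is the zero energy space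
`(⊥ : Submodule ℝ ℝ)`. Junk-model audit for stmt-NavierStokesRegularity-0269/0270 (refuter). [folklore] -/
theorem exists_frame_iff_scalar (d : BlowupProfileData) :
    (∃ F : StabilityFrame d, BlowupProfileConditions d F) ↔
      0 ≤ d.residualBound ∧ (∃ Estar : ℝ, d.ClosureAt Estar) ∧ d.ExponentsAdmissible := by
  constructor
  · rintro ⟨F, h⟩
    refine ⟨?_, h.closure, h.exponents⟩
    have := (norm_nonneg _).trans h.residual_le
    exact_mod_cast this
  · rintro ⟨hε, hclos, hexp⟩
    -- junk model: the zero energy space `(⊥ : Submodule ℝ ℝ)`, everything zero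
    have hn : ∀ v : (⊥ : Submodule ℝ ℝ), ‖v‖ = 0 := fun v => by
      rw [Subsingleton.elim v 0]; exact norm_zero
    let F : StabilityFrame d :=
      { X := (⊥ : Submodule ℝ ℝ)
        reconstruct := fun _ => 0
        residual := 0
        linForm := fun _ => 0
        nonlinForms := d.nonlinearConsts.map fun _ => fun _ => 0 }
    refine ⟨F, ?_, ?_, ?_, hclos, hexp⟩
    · change ‖(0 : (⊥ : Submodule ℝ ℝ))‖ ≤ (d.residualBound : ℝ)
      rw [hn]; exact_mod_cast hε
    · intro v _
      change (0 : ℝ) ≤ -(d.coercivity : ℝ) * ‖(v : (⊥ : Submodule ℝ ℝ))‖ ^ 2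
      rw [hn v]
      simp
    · change List.Forall₂
          (fun (N : (⊥ : Submodule ℝ ℝ) → ℝ) (c : ℚ) => ∀ v : (⊥ : Submodule ℝ ℝ), |N v| ≤ (c : ℝ) * ‖v‖ ^ 3)
          (d.nonlinearConsts.map fun _ => fun _ => (0 : ℝ)) d.nonlinearConsts
      have key : ∀ cs : List ℚ, List.Forall₂
          (fun (N : (⊥ : Submodule ℝ ℝ) → ℝ) (c : ℚ) => ∀ v : (⊥ : Submodule ℝ ℝ), |N v| ≤ (c : ℝ) * ‖v‖ ^ 3)
          (cs.map fun _ => fun _ => (0 : ℝ)) cs := by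
        intro cs
        induction cs with
        | nil => exact List.Forall₂.nil
        | cons c cs ih =>
          refine List.Forall₂.cons ?_ ih
          intro v
          rw [hn v]
          simp
      exact key _

end Literature.NS

end
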